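import Summits.SmoothPoincare4.SmoothPoincare4.Theorems.SymplecticOrigamiOrigamiFoldExistenceStubPleatFreeStandardSeam

/-!
# Stub `stub_pleatFreeStandard` of line `shadow-pleats` for crux `OrigamiFoldExistence` — III: sheet counting
(item stmt-SmoothPoincare4-7844, route route-SmoothPoincare4-SymplecticOrigami; line lead seat 1)

Third of four files (same unbundled setting as file II, plus compactness of `M`).  Proved here:

* `exists_nhds_injOn` — at positive height the shadow is an injective open map on a small open
  neighbourhood (the local diffeomorphism of file II read as an open partial homeomorphism);
* MAXIMUM PRINCIPLE `not_lt_height_of_isMaxOn` / `norm_shadow_le` / `norm_shadow_lt` — on the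
  compact `K = {h ≥ 1 - δ}` the norm of the shadow is maximal only on the seam (an open map into
  `ℝ⁴` cannot have an interior maximum of `‖·‖`), so the part `M⁺ = {h > 1 - δ}` casts its shadow
  into the OPEN ball of radius `ρ`;
* SHEET COUNTING `exists_good_point` / `existsUnique_preimage` — over every point of that open
  ball, `M⁺` has EXACTLY ONE point: the loci "exactly one sheet", "at least two sheets",
  "no sheet" are open in the ball (properness via compactness of `K`, Hausdorffness of `M`), the
  first is met just inside the rim (one sheet continues the seam, where the shadow is a local
  chart and the seam is embedded), and the ball is connected.  This is the covering-space /
  sheet-counting step of the planner's sketch (the line card's "`Φ = g ∪ id` is a one-sheeted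
  covering of `ℂ²`"), done directly by a connectedness count, with no covering-space theory and
  no manifold-with-boundary bookkeeping.

Sources: skeleton docstring of `stub_pleatFreeStandard` (Cruxes/OrigamiFoldExistence/Lines/
shadow_pleats.lean; Palais 1960 / Brown 1960 / Gabai–Naylor–Schwartz sheet counting as cited
there); the argument itself is elementary point-set topology over files I–II.
-/

noncomputable section

-- the prescribed namespace `Summit.<P>.<Sub>.…` duplicates `SmoothPoincare4` (P = Sub)
set_option linter.dupNamespace false

open scoped Manifold ContDiff Topology RealInnerProductSpace
open Set Function Filter Metric ContinuousMap

namespace Summit.SmoothPoincare4.SmoothPoincare4.Theorems.OrigamiFoldExistence.ShadowPleats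

section ZeroPleat

variable {M : Type} [TopologicalSpace M] [ChartedSpace (EuclideanSpace ℝ (Fin 4)) M]
  {ι : M → EuclideanSpace ℝ (Fin 5)} {δ : ℝ} [IsManifold (𝓡 4) ∞ M]

/-! ### Local charts of the shadow at points of positive height -/

/-- At a point of positive height the shadow restricts to an injective open map on an open
neighbourhood (a local diffeomorphism read as an open partial homeomorphism). -/
theorem exists_nhds_injOn (hι : Manifold.IsSmoothEmbedding (𝓡 4) (𝓡 5) ∞ ι)
    (hδ : 0 < δ) (hδ1 : δ < 1)
    (hround : Set.range ι ∩ {p : (EuclideanSpace ℝ (Fin 5)) | p 4 ≤ 1 - δ} = (Metric.sphere (0 : EuclideanSpace ℝ (Fin 5)) 1 : Set (EuclideanSpace ℝ (Fin 5))) ∩ {p : (EuclideanSpace ℝ (Fin 5)) | p 4 ≤ 1 - δ})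
    (hinj : ∀ m : M, 1 - δ < ι m 4 → Injective (mfderiv (𝓡 4) (𝓡 4) (proj5 ∘ ι) m))
    {m : M} (hpos : 0 < ι m 4) {W : Set M} (hW : IsOpen W) (hmW : m ∈ W) :
    ∃ U : Set M, IsOpen U ∧ m ∈ U ∧ U ⊆ W ∧ InjOn (proj5 ∘ ι) U ∧
      ∀ V, V ⊆ U → IsOpen V → IsOpen ((proj5 ∘ ι) '' V) := by
  obtain ⟨Φ, hmΦ, heq⟩ := isLocalDiffeomorphAt_shadow_of_pos hι hδ hδ1 hround hinj hpos
  refine ⟨Φ.source ∩ W, Φ.open_source.inter hW, ⟨hmΦ, hmW⟩, inter_subset_right, ?_, ?_⟩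
  · intro a ha b hb hab
    have hab' : Φ a = Φ b := by rw [← heq ha.1, ← heq hb.1]; exact hab
    exact Φ.toPartialEquiv.injOn ha.1 hb.1 hab'
  · intro V hV hVopen
    have hVs : V ⊆ Φ.source := fun x hx => (hV hx).1
    have himg : (proj5 ∘ ι) '' V = Φ.toOpenPartialHomeomorph '' V :=
      image_congr fun x hx => heq (hVs hx)
    rw [himg]
    exact Φ.toOpenPartialHomeomorph.isOpen_image_of_subset_source hVopen hVs

/-! ### The maximum principle: the upper part `M⁺ = {h > 1 - δ}` casts its shadow inside the
open ball of radius `ρ` -/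

/-- **No interior maximum.** A point of `K = {h ≥ 1 - δ}` where `‖shadow‖` is maximal on `K`
is not strictly above the plane (the shadow is an open map there, and `‖·‖` has no local
maximum on an open set of `ℝ⁴` — except at `0`, excluded by the seam). -/
theorem not_lt_height_of_isMaxOn (hι : Manifold.IsSmoothEmbedding (𝓡 4) (𝓡 5) ∞ ι)
    (hδ : 0 < δ) (hδ1 : δ < 1)
    (hround : Set.range ι ∩ {p : (EuclideanSpace ℝ (Fin 5)) | p 4 ≤ 1 - δ} = (Metric.sphere (0 : EuclideanSpace ℝ (Fin 5)) 1 : Set (EuclideanSpace ℝ (Fin 5))) ∩ {p : (EuclideanSpace ℝ (Fin 5)) | p 4 ≤ 1 - δ})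
    (hinj : ∀ m : M, 1 - δ < ι m 4 → Injective (mfderiv (𝓡 4) (𝓡 4) (proj5 ∘ ι) m))
    {m₀ : M} (hmax : IsMaxOn (fun m => ‖proj5 (ι m)‖) {m : M | 1 - δ ≤ ι m 4} m₀) :
    ¬ 1 - δ < ι m₀ 4 := by
  intro hgt
  have hpos : 0 < ι m₀ 4 := by linarith
  have hopen : IsOpen {m : M | 1 - δ < ι m 4} := isOpen_lt continuous_const (continuous_height hι)
  obtain ⟨U, hU, hmU, hUW, -, himg⟩ :=
    exists_nhds_injOn hι hδ hδ1 hround hinj hpos hopen hgt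
  have hUimg : IsOpen ((proj5 ∘ ι) '' U) := himg U Subset.rfl hU
  set x₀ : (EuclideanSpace ℝ (Fin 4)) := proj5 (ι m₀) with hx₀
  have hx₀mem : x₀ ∈ (proj5 ∘ ι) '' U := ⟨m₀, hmU, rfl⟩
  obtain ⟨ε, hε, hball⟩ := Metric.isOpen_iff.1 hUimg x₀ hx₀mem
  -- every point of `U` is in `K`, hence has shadow of norm `≤ ‖x₀‖`
  have hle : ∀ m ∈ U, ‖proj5 (ι m)‖ ≤ ‖x₀‖ := fun m hm =>
    hmax (show (1 : ℝ) - δ ≤ ι m 4 from (hUW hm).le)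
  by_cases hx : x₀ = 0
  · -- the seam has shadow of norm `ρ > 0`
    obtain ⟨ms, hms⟩ := exists_seam hδ hδ1 hround
    have h1 : ‖proj5 (ι ms)‖ ≤ ‖x₀‖ := hmax (show (1 : ℝ) - δ ≤ ι ms 4 from le_of_eq hms.symm)
    rw [norm_shadow_of_seam hround hms, hx, norm_zero] at h1
    have h2 : 0 < Real.sqrt (1 - (1 - δ) ^ 2) := Real.sqrt_pos.2 (by nlinarith)
    linarith
  · have hxpos : 0 < ‖x₀‖ := norm_pos_iff.2 hx
    set t : ℝ := ε / (2 * ‖x₀‖) with ht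
    have htpos : 0 < t := by positivity
    have hy : (1 + t) • x₀ ∈ Metric.ball x₀ ε := by
      rw [Metric.mem_ball, dist_eq_norm, add_smul, one_smul, add_sub_cancel_left, norm_smul,
        Real.norm_eq_abs, abs_of_pos htpos, ht]
      field_simp
      linarith
    obtain ⟨m', hm'U, hm'x⟩ := hball hy
    have h1 := hle m' hm'U
    have h2 : ‖proj5 (ι m')‖ = (1 + t) * ‖x₀‖ := by
      have : proj5 (ι m') = (1 + t) • x₀ := hm'x
      rw [this, norm_smul, Real.norm_eq_abs, abs_of_pos (by linarith)]
    rw [h2] at h1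
    nlinarith

/-- **The shadow of `K = {h ≥ 1 - δ}` lies in the closed ball of radius `ρ`.** -/
theorem norm_shadow_le [CompactSpace M] (hι : Manifold.IsSmoothEmbedding (𝓡 4) (𝓡 5) ∞ ι)
    (hδ : 0 < δ) (hδ1 : δ < 1)
    (hround : Set.range ι ∩ {p : (EuclideanSpace ℝ (Fin 5)) | p 4 ≤ 1 - δ} = (Metric.sphere (0 : EuclideanSpace ℝ (Fin 5)) 1 : Set (EuclideanSpace ℝ (Fin 5))) ∩ {p : (EuclideanSpace ℝ (Fin 5)) | p 4 ≤ 1 - δ})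
    (hinj : ∀ m : M, 1 - δ < ι m 4 → Injective (mfderiv (𝓡 4) (𝓡 4) (proj5 ∘ ι) m))
    {m : M} (hm : 1 - δ ≤ ι m 4) : ‖proj5 (ι m)‖ ≤ Real.sqrt (1 - (1 - δ) ^ 2) := by
  have hK : IsCompact {m : M | 1 - δ ≤ ι m 4} :=
    (isClosed_le continuous_const (continuous_height hι)).isCompact
  obtain ⟨ms, hms⟩ := exists_seam hδ hδ1 hround
  have hne : ({m : M | 1 - δ ≤ ι m 4}).Nonempty := ⟨ms, le_of_eq hms.symm⟩
  have hcont : Continuous fun m => ‖proj5 (ι m)‖ := (contMDiff_shadow hι).continuous.norm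
  obtain ⟨m₀, hm₀K, hmax⟩ := hK.exists_isMaxOn hne hcont.continuousOn
  have hm₀eq : ι m₀ 4 = 1 - δ := by
    have := not_lt_height_of_isMaxOn hι hδ hδ1 hround hinj hmax
    exact le_antisymm (not_lt.1 this) hm₀K
  calc ‖proj5 (ι m)‖ ≤ ‖proj5 (ι m₀)‖ := hmax hm
    _ = Real.sqrt (1 - (1 - δ) ^ 2) := norm_shadow_of_seam hround hm₀eq

/-- **Strictly above the plane the shadow lies in the OPEN ball of radius `ρ`.** -/
theorem norm_shadow_lt [CompactSpace M] (hι : Manifold.IsSmoothEmbedding (𝓡 4) (𝓡 5) ∞ ι)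
    (hδ : 0 < δ) (hδ1 : δ < 1)
    (hround : Set.range ι ∩ {p : (EuclideanSpace ℝ (Fin 5)) | p 4 ≤ 1 - δ} = (Metric.sphere (0 : EuclideanSpace ℝ (Fin 5)) 1 : Set (EuclideanSpace ℝ (Fin 5))) ∩ {p : (EuclideanSpace ℝ (Fin 5)) | p 4 ≤ 1 - δ})
    (hinj : ∀ m : M, 1 - δ < ι m 4 → Injective (mfderiv (𝓡 4) (𝓡 4) (proj5 ∘ ι) m))
    {m : M} (hm : 1 - δ < ι m 4) : ‖proj5 (ι m)‖ < Real.sqrt (1 - (1 - δ) ^ 2) := by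
  rcases (norm_shadow_le hι hδ hδ1 hround hinj hm.le).lt_or_eq with h | h
  · exact h
  · exfalso
    have hmax : IsMaxOn (fun m => ‖proj5 (ι m)‖) {m : M | 1 - δ ≤ ι m 4} m := by
      intro m' hm'
      have := norm_shadow_le hι hδ hδ1 hround hinj hm'
      simpa only [mem_setOf_eq, h] using this
    exact not_lt_height_of_isMaxOn hι hδ hδ1 hround hinj hmax hm

/-! ### Sheet counting over the open ball -/

/-- **Exactly one sheet near the rim.** There is a point of the open ball of radius `ρ` over which
`M⁺ = {h > 1 - δ}` has exactly one point. -/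
theorem exists_good_point [CompactSpace M] (hι : Manifold.IsSmoothEmbedding (𝓡 4) (𝓡 5) ∞ ι)
    (hδ : 0 < δ) (hδ1 : δ < 1)
    (hround : Set.range ι ∩ {p : (EuclideanSpace ℝ (Fin 5)) | p 4 ≤ 1 - δ} = (Metric.sphere (0 : EuclideanSpace ℝ (Fin 5)) 1 : Set (EuclideanSpace ℝ (Fin 5))) ∩ {p : (EuclideanSpace ℝ (Fin 5)) | p 4 ≤ 1 - δ})
    (hinj : ∀ m : M, 1 - δ < ι m 4 → Injective (mfderiv (𝓡 4) (𝓡 4) (proj5 ∘ ι) m)) :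
    ∃ x : (EuclideanSpace ℝ (Fin 4)), ‖x‖ < Real.sqrt (1 - (1 - δ) ^ 2) ∧ ∃ m₁ : M, 1 - δ < ι m₁ 4 ∧ proj5 (ι m₁) = x ∧
      ∀ m' : M, 1 - δ < ι m' 4 → proj5 (ι m') = x → m' = m₁ := by
  set ρ := Real.sqrt (1 - (1 - δ) ^ 2) with hρ
  have hρpos : 0 < ρ := Real.sqrt_pos.2 (by nlinarith)
  obtain ⟨ms, hms⟩ := exists_seam hδ hδ1 hround
  have hpos : 0 < ι ms 4 := by rw [hms]; linarith
  have hWopen : IsOpen {m : M | 0 < ι m 4} := isOpen_lt continuous_const (continuous_height hι)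
  obtain ⟨U, hU, hmsU, hUW, hinjU, himg⟩ :=
    exists_nhds_injOn hι hδ hδ1 hround hinj hpos hWopen hpos
  set xs : (EuclideanSpace ℝ (Fin 4)) := proj5 (ι ms) with hxs
  have hxsnorm : ‖xs‖ = ρ := norm_shadow_of_seam hround hms
  -- (a) the shadow of the compact `K \ U` misses `xs`
  have hK : IsCompact {m : M | 1 - δ ≤ ι m 4} :=
    (isClosed_le continuous_const (continuous_height hι)).isCompact
  have hC : IsCompact ({m : M | 1 - δ ≤ ι m 4} \ U) := hK.diff hU
  have hcont : Continuous (proj5 ∘ ι) := (contMDiff_shadow hι).continuous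
  have hCimg : IsClosed ((proj5 ∘ ι) '' ({m : M | 1 - δ ≤ ι m 4} \ U)) :=
    (hC.image hcont).isClosed
  have hxs_not : xs ∉ (proj5 ∘ ι) '' ({m : M | 1 - δ ≤ ι m 4} \ U) := by
    rintro ⟨c, ⟨hcK, hcU⟩, hcx⟩
    have hcx' : proj5 (ι c) = xs := hcx
    have hcK' : 1 - δ ≤ ι c 4 := hcK
    -- `c` is not strictly above the plane (its shadow has norm `ρ`), so it is on the seam
    have hceq : ι c 4 = 1 - δ := by
      rcases hcK'.lt_or_eq with h | h
      · have := norm_shadow_lt hι hδ hδ1 hround hinj h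
        rw [hcx', hxsnorm] at this
        exact absurd this (lt_irrefl _)
      · exact h.symm
    -- two points of the sphere with the same shadow and the same height coincide
    have hιeq : ι c = ι ms := by
      rw [← embedL_proj5_add_smul (ι c), ← embedL_proj5_add_smul (ι ms), hcx', hceq, hms]
    exact hcU (hι.isEmbedding.injective hιeq ▸ hmsU)
  obtain ⟨ε₁, hε₁, hball₁⟩ := Metric.isOpen_iff.1 hCimg.isOpen_compl xs hxs_not
  -- (b) the shadow of `U` is an open neighbourhood of `xs`
  obtain ⟨ε₂, hε₂, hball₂⟩ := Metric.isOpen_iff.1 (himg U Subset.rfl hU) xs ⟨ms, hmsU, rfl⟩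
  -- (c) the test point `x = (1 - t) xs`, just inside the rim
  set t : ℝ := min (1 / 2) (min ε₁ ε₂ / (2 * ρ)) with ht
  have htpos : 0 < t := by positivity
  have htle : t ≤ 1 / 2 := min_le_left _ _
  have htρ : t * ρ < min ε₁ ε₂ := by
    have : t ≤ min ε₁ ε₂ / (2 * ρ) := min_le_right _ _
    calc t * ρ ≤ min ε₁ ε₂ / (2 * ρ) * ρ := by gcongr
      _ = min ε₁ ε₂ / 2 := by field_simp
      _ < min ε₁ ε₂ := by linarith [lt_min hε₁ hε₂]
  set x : (EuclideanSpace ℝ (Fin 4)) := (1 - t) • xs with hx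
  have hxdist : dist x xs = t * ρ := by
    rw [hx, dist_eq_norm, sub_smul, one_smul, sub_sub_cancel_left, norm_neg, norm_smul,
      Real.norm_eq_abs, abs_of_pos htpos, hxsnorm]
  have hxnorm : ‖x‖ < ρ := by
    rw [hx, norm_smul, Real.norm_eq_abs, abs_of_pos (by linarith), hxsnorm]
    nlinarith
  have hx₁ : x ∈ Metric.ball xs ε₁ := by
    rw [Metric.mem_ball, hxdist]; exact lt_of_lt_of_le htρ (min_le_left _ _)
  have hx₂ : x ∈ Metric.ball xs ε₂ := by
    rw [Metric.mem_ball, hxdist]; exact lt_of_lt_of_le htρ (min_le_right _ _)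
  -- the preimage in `U` is above the plane
  obtain ⟨m₁, hm₁U, hm₁x⟩ := hball₂ hx₂
  have hm₁x' : proj5 (ι m₁) = x := hm₁x
  have hm₁pos : 0 < ι m₁ 4 := hUW hm₁U
  have hm₁up : 1 - δ < ι m₁ 4 := by
    by_contra hle
    have := rho_le_norm_shadow hround hm₁pos (not_lt.1 hle)
    rw [hm₁x'] at this
    linarith
  refine ⟨x, hxnorm, m₁, hm₁up, hm₁x', fun m' hm' hm'x => ?_⟩
  -- any other preimage above the plane lies in `U` (else its shadow would be in the closed set)
  have hm'U : m' ∈ U := by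
    by_contra hnot
    have : x ∈ (proj5 ∘ ι) '' ({m : M | 1 - δ ≤ ι m 4} \ U) := ⟨m', ⟨hm'.le, hnot⟩, hm'x⟩
    exact hball₁ hx₁ this
  exact hinjU hm'U hm₁U (by simp only [Function.comp_apply, hm'x, hm₁x'])

/-- **All fibres over the open ball are singletons**: for every `x` with `‖x‖ < ρ` there is exactly
one point of `M⁺ = {h > 1 - δ}` with shadow `x` (the sets "exactly one", "at least two" and "none"
are open in the ball, the first is nonempty by `exists_good_point`, and the ball is connected). -/
theorem existsUnique_preimage [CompactSpace M] [T2Space M]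
    (hι : Manifold.IsSmoothEmbedding (𝓡 4) (𝓡 5) ∞ ι) (hδ : 0 < δ) (hδ1 : δ < 1)
    (hround : Set.range ι ∩ {p : EuclideanSpace ℝ (Fin 5) | p 4 ≤ 1 - δ} =
      (Metric.sphere (0 : EuclideanSpace ℝ (Fin 5)) 1 : Set (EuclideanSpace ℝ (Fin 5))) ∩
        {p : EuclideanSpace ℝ (Fin 5) | p 4 ≤ 1 - δ})
    (hinj : ∀ m : M, 1 - δ < ι m 4 → Injective (mfderiv (𝓡 4) (𝓡 4) (proj5 ∘ ι) m))
    {x : EuclideanSpace ℝ (Fin 4)} (hx : ‖x‖ < Real.sqrt (1 - (1 - δ) ^ 2)) :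
    ∃ m₁ : M, 1 - δ < ι m₁ 4 ∧ proj5 (ι m₁) = x ∧
      ∀ m' : M, 1 - δ < ι m' 4 → proj5 (ι m') = x → m' = m₁ := by
  set ρ := Real.sqrt (1 - (1 - δ) ^ 2) with hρ
  -- the three predicates
  set Good : (EuclideanSpace ℝ (Fin 4)) → Prop := fun y => ∃ m₁ : M, 1 - δ < ι m₁ 4 ∧ proj5 (ι m₁) = y ∧
      ∀ m' : M, 1 - δ < ι m' 4 → proj5 (ι m') = y → m' = m₁ with hGood
  set Many : (EuclideanSpace ℝ (Fin 4)) → Prop := fun y => ∃ a b : M, 1 - δ < ι a 4 ∧ 1 - δ < ι b 4 ∧ a ≠ b ∧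
      proj5 (ι a) = y ∧ proj5 (ι b) = y with hMany
  set None' : (EuclideanSpace ℝ (Fin 4)) → Prop := fun y => ∀ m' : M, 1 - δ < ι m' 4 → proj5 (ι m') ≠ y with hNone
  have hK : IsCompact {m : M | 1 - δ ≤ ι m 4} :=
    (isClosed_le continuous_const (continuous_height hι)).isCompact
  have hcont : Continuous (proj5 ∘ ι) := (contMDiff_shadow hι).continuous
  have hMplus : IsOpen {m : M | 1 - δ < ι m 4} := isOpen_lt continuous_const (continuous_height hι)
  -- trichotomy on the ball
  have htri : ∀ y : (EuclideanSpace ℝ (Fin 4)), Good y ∨ Many y ∨ None' y := by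
    intro y
    by_cases hex : ∃ m₁ : M, 1 - δ < ι m₁ 4 ∧ proj5 (ι m₁) = y
    · obtain ⟨m₁, hm₁, hm₁y⟩ := hex
      by_cases huniq : ∀ m' : M, 1 - δ < ι m' 4 → proj5 (ι m') = y → m' = m₁
      · exact Or.inl ⟨m₁, hm₁, hm₁y, huniq⟩
      · push Not at huniq
        obtain ⟨m', hm', hm'y, hne⟩ := huniq
        exact Or.inr (Or.inl ⟨m', m₁, hm', hm₁, hne, hm'y, hm₁y⟩)
    · push Not at hex
      exact Or.inr (Or.inr fun m' hm' h => hex m' hm' h)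
  -- `Good` is open inside the ball
  have hGoodOpen : IsOpen {y : (EuclideanSpace ℝ (Fin 4)) | ‖y‖ < ρ ∧ Good y} := by
    rw [Metric.isOpen_iff]
    rintro y ⟨hy, m₁, hm₁, hm₁y, huniq⟩
    obtain ⟨U, hU, hm₁U, hUW, hinjU, himg⟩ :=
      exists_nhds_injOn hι hδ hδ1 hround hinj (by linarith : 0 < ι m₁ 4) hMplus hm₁
    have hC : IsClosed ((proj5 ∘ ι) '' ({m : M | 1 - δ ≤ ι m 4} \ U)) :=
      ((hK.diff hU).image hcont).isClosed
    have hy_not : y ∉ (proj5 ∘ ι) '' ({m : M | 1 - δ ≤ ι m 4} \ U) := by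
      rintro ⟨c, ⟨hcK, hcU⟩, hcy⟩
      have hcy' : proj5 (ι c) = y := hcy
      have hcK' : 1 - δ ≤ ι c 4 := hcK
      have hcup : 1 - δ < ι c 4 := lt_height_of_norm_lt hround hcK' (by rw [hcy']; exact hy)
      exact hcU (huniq c hcup hcy' ▸ hm₁U)
    obtain ⟨ε₁, hε₁, hball₁⟩ := Metric.isOpen_iff.1 hC.isOpen_compl y hy_not
    obtain ⟨ε₂, hε₂, hball₂⟩ := Metric.isOpen_iff.1 (himg U Subset.rfl hU) y ⟨m₁, hm₁U, hm₁y⟩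
    obtain ⟨ε₃, hε₃, hball₃⟩ := Metric.isOpen_iff.1 (Metric.isOpen_ball (x := (0 : (EuclideanSpace ℝ (Fin 4)))) (ε := ρ))
      y (by simpa using hy)
    refine ⟨min ε₁ (min ε₂ ε₃), by positivity, fun z hz => ?_⟩
    have hz₁ : z ∈ Metric.ball y ε₁ := Metric.ball_subset_ball (min_le_left _ _) hz
    have hz₂ : z ∈ Metric.ball y ε₂ :=
      Metric.ball_subset_ball ((min_le_right _ _).trans (min_le_left _ _)) hz
    have hz₃ : z ∈ Metric.ball y ε₃ :=
      Metric.ball_subset_ball ((min_le_right _ _).trans (min_le_right _ _)) hz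
    have hznorm : ‖z‖ < ρ := by simpa using hball₃ hz₃
    obtain ⟨mz, hmzU, hmzz⟩ := hball₂ hz₂
    have hmzz' : proj5 (ι mz) = z := hmzz
    refine ⟨hznorm, mz, hUW hmzU, hmzz', fun m' hm' hm'z => ?_⟩
    have hm'U : m' ∈ U := by
      by_contra hnot
      exact hball₁ hz₁ ⟨m', ⟨hm'.le, hnot⟩, hm'z⟩
    exact hinjU hm'U hmzU (by simp only [Function.comp_apply, hm'z, hmzz'])
  -- `Many` is open
  have hManyOpen : IsOpen {y : (EuclideanSpace ℝ (Fin 4)) | Many y} := by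
    rw [Metric.isOpen_iff]
    rintro y ⟨a, b, ha, hb, hne, hay, hby⟩
    obtain ⟨ua, ub, hua, hub, haua, hbub, hdisj⟩ := t2_separation hne
    obtain ⟨Ua, hUa, haUa, hUaW, -, himga⟩ :=
      exists_nhds_injOn hι hδ hδ1 hround hinj (by linarith : 0 < ι a 4) (hMplus.inter hua)
        ⟨ha, haua⟩
    obtain ⟨Ub, hUb, hbUb, hUbW, -, himgb⟩ :=
      exists_nhds_injOn hι hδ hδ1 hround hinj (by linarith : 0 < ι b 4) (hMplus.inter hub)
        ⟨hb, hbub⟩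
    obtain ⟨εa, hεa, hballa⟩ := Metric.isOpen_iff.1 (himga Ua Subset.rfl hUa) y ⟨a, haUa, hay⟩
    obtain ⟨εb, hεb, hballb⟩ := Metric.isOpen_iff.1 (himgb Ub Subset.rfl hUb) y ⟨b, hbUb, hby⟩
    refine ⟨min εa εb, by positivity, fun z hz => ?_⟩
    obtain ⟨a', ha'U, ha'z⟩ := hballa (Metric.ball_subset_ball (min_le_left _ _) hz)
    obtain ⟨b', hb'U, hb'z⟩ := hballb (Metric.ball_subset_ball (min_le_right _ _) hz)
    have hne' : a' ≠ b' := by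
      intro h
      have h1 : a' ∈ ua := (hUaW ha'U).2
      have h2 : a' ∈ ub := h ▸ (hUbW hb'U).2
      exact Set.disjoint_left.1 hdisj h1 h2
    exact ⟨a', b', (hUaW ha'U).1, (hUbW hb'U).1, hne', ha'z, hb'z⟩
  -- `None'` is open inside the ball
  have hNoneOpen : IsOpen {y : (EuclideanSpace ℝ (Fin 4)) | ‖y‖ < ρ ∧ None' y} := by
    rw [Metric.isOpen_iff]
    rintro y ⟨hy, hnone⟩
    have hC : IsClosed ((proj5 ∘ ι) '' {m : M | 1 - δ ≤ ι m 4}) := (hK.image hcont).isClosed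
    have hy_not : y ∉ (proj5 ∘ ι) '' {m : M | 1 - δ ≤ ι m 4} := by
      rintro ⟨c, hcK, hcy⟩
      have hcy' : proj5 (ι c) = y := hcy
      have hcK' : 1 - δ ≤ ι c 4 := hcK
      exact hnone c (lt_height_of_norm_lt hround hcK' (by rw [hcy']; exact hy)) hcy'
    obtain ⟨ε₁, hε₁, hball₁⟩ := Metric.isOpen_iff.1 hC.isOpen_compl y hy_not
    obtain ⟨ε₃, hε₃, hball₃⟩ := Metric.isOpen_iff.1 (Metric.isOpen_ball (x := (0 : (EuclideanSpace ℝ (Fin 4)))) (ε := ρ))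
      y (by simpa using hy)
    refine ⟨min ε₁ ε₃, by positivity, fun z hz => ?_⟩
    have hz₁ : z ∈ Metric.ball y ε₁ := Metric.ball_subset_ball (min_le_left _ _) hz
    have hz₃ : z ∈ Metric.ball y ε₃ := Metric.ball_subset_ball (min_le_right _ _) hz
    refine ⟨by simpa using hball₃ hz₃, fun m' hm' hm'z => ?_⟩
    exact hball₁ hz₁ ⟨m', hm'.le, hm'z⟩
  -- connectedness of the ball
  have hpre : IsPreconnected (Metric.ball (0 : (EuclideanSpace ℝ (Fin 4))) ρ) := (convex_ball (0 : (EuclideanSpace ℝ (Fin 4))) ρ).isPreconnected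
  obtain ⟨x₀, hx₀, hGood₀⟩ := exists_good_point hι hδ hδ1 hround hinj
  set V : Set (EuclideanSpace ℝ (Fin 4)) := {y : (EuclideanSpace ℝ (Fin 4)) | Many y} ∪ {y : (EuclideanSpace ℝ (Fin 4)) | ‖y‖ < ρ ∧ None' y} with hV
  have hVopen : IsOpen V := hManyOpen.union hNoneOpen
  have hcover : Metric.ball (0 : (EuclideanSpace ℝ (Fin 4))) ρ ⊆ {y : (EuclideanSpace ℝ (Fin 4)) | ‖y‖ < ρ ∧ Good y} ∪ V := by
    intro y hy
    have hy' : ‖y‖ < ρ := by simpa using hy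
    rcases htri y with h | h | h
    · exact Or.inl ⟨hy', h⟩
    · exact Or.inr (Or.inl h)
    · exact Or.inr (Or.inr ⟨hy', h⟩)
  -- if `x` were not Good, the ball would meet both open sets, hence their intersection
  by_contra hxnot
  have hxV : x ∈ V := by
    rcases htri x with h | h | h
    · exact absurd h hxnot
    · exact Or.inl h
    · exact Or.inr ⟨hx, h⟩
  have hne1 : (Metric.ball (0 : (EuclideanSpace ℝ (Fin 4))) ρ ∩ {y : (EuclideanSpace ℝ (Fin 4)) | ‖y‖ < ρ ∧ Good y}).Nonempty :=
    ⟨x₀, by simpa using hx₀, hx₀, hGood₀⟩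
  have hne2 : (Metric.ball (0 : (EuclideanSpace ℝ (Fin 4))) ρ ∩ V).Nonempty := ⟨x, by simpa using hx, hxV⟩
  obtain ⟨y, -, ⟨-, hyGood⟩, hyV⟩ := hpre _ _ hGoodOpen hVopen hcover hne1 hne2
  obtain ⟨m₁, hm₁, hm₁y, huniq⟩ := hyGood
  rcases hyV with ⟨a, b, ha, hb, hne, hay, hby⟩ | ⟨-, hnone⟩
  · exact hne ((huniq a ha hay).trans (huniq b hb hby).symm)
  · exact hnone m₁ hm₁ hm₁y

end ZeroPleat

end Summit.SmoothPoincare4.SmoothPoincare4.Theorems.OrigamiFoldExistence.ShadowPleats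

end
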